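import Literature.NumberTheory.Transcendental.NewPoints
import Literature.NumberTheory.Transcendental.AuxiliaryFunctionSharp
import HarnessLib

/-!
# Baker's method on `M_κ`: the engine (Siegel step + extrapolation), assembled

Topic: `Literature/NumberTheory/Transcendental`. Plan item W4/S1–S5 (assembly) of the unit
`provefact-Literature.NumberTheory.Transcendental.H-b596640137`. One statement combining the
construction of the auxiliary form (`AuxiliaryFunctionSharp.exists_auxiliary₂`: Siegel's lemma with
the sharp count of conditions) with
the extrapolation to new points (`NewPoints.vanishesAlong_newPoints`: Schwarz lemma, Liouville,
grid lemma): for Baker data `B` with `v ∈ 𝔟 = ⟨x_m⟩` and parameters `(D', T, S₀, S₁, T', R)`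
satisfying Siegel feasibility and the numerical condition `NumCond` for every coefficient vector
within the Siegel house bound, there is a form `P` of degree `nD'` with `F_P ≢ 0` on `M_κ`
vanishing to order `≥ T'` along `𝔟` at `s·v` for all `s ≤ S₁` — the hypothesis of Philippon's
zero estimate (`PhilipponZeroEstimateStd.philippon1986_std`). PROVED (`BakerData.engine`).

## References

* A. Baker, G. Wüstholz, *Logarithmic Forms and Diophantine Geometry*, CUP 2007, §6.8.
-/

noncomputable section

open Complex MvPolynomial Finset NumberField
open scoped PeriodPair

namespace Literature.NumberTheory.Transcendental

namespace GaGmE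

namespace Std

namespace BakerData

variable {β γ δ : Type} [Fintype β] [Fintype γ] [Fintype δ] [DecidableEq γ]
variable [DecidableEq β] [DecidableEq δ] (B : BakerData β γ δ)

/-- The Siegel house bound for the coefficients `ξ_u` (`SiegelWrapper.siegelConst`). [folklore] -/
def siegelHouseBound (D' T S₀ : ℕ) : ℝ :=
  siegelConst B.K * (siegelConst B.K * ((D' + 1) ^ Fintype.card (β ⊕ (γ ⊕ δ)) : ℕ) * B.houseBound D' T S₀) ^
    ((((S₀ + 1) * T ^ B.dd : ℕ) : ℝ) /
      ((((D' + 1) ^ Fintype.card (β ⊕ (γ ⊕ δ)) : ℕ) : ℝ) - ((S₀ + 1) * T ^ B.dd : ℕ)))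

/-- **The Baker engine on `M_κ`.** Let `v ∈ 𝔟`, `T ≥ 1`, `(S₀+1)·T^{dd} < (D'+1)^n` (Siegel
feasibility, sharp count), `R > 0`, `R ≥ 2(S₁ + S₀)`, and suppose the numerical condition `NumCond` holds for
every coefficient vector `ξ` whose houses are within the Siegel bound. Then there is a form `P`,
homogeneous of degree `nD'`, with `F_P ≢ 0` and `F_P` vanishing to order `≥ T'` along `𝔟` at `s·v`
for all `s ≤ S₁`. [cite: BakerWustholz2007, §6.8 (pp. 118–119)] -/
theorem engine (hv : B.v ∈ B.bSpan) (D' T S₀ S₁ T' : ℕ) (R : ℝ) (hT : 0 < T)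
    (hpq : (S₀ + 1) * T ^ B.dd < (D' + 1) ^ Fintype.card (β ⊕ (γ ⊕ δ)))
    (hR0 : 0 < R) (hR : 2 * ((S₁ : ℝ) + S₀) ≤ R)
    (hnum : ∀ ξ : UIdx β γ δ D' → 𝓞 B.K,
      (∀ u, house ((ξ u : 𝓞 B.K) : B.K) ≤ B.siegelHouseBound D' T S₀) → B.NumCond ξ T S₀ S₁ T' R) :
    ∃ P : MvPolynomial (Option β × ThetaIdx γ δ) ℂ,
      P.IsHomogeneous (Fintype.card (β ⊕ (γ ⊕ δ)) * D') ∧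
      (∃ w, thetaEval B.L B.κM P w ≠ 0) ∧
      ∀ s : ℕ, s ≤ S₁ → VanishesAlong B.bSpan (thetaEval B.L B.κM P) ((s : ℂ) • B.v) T' := by
  obtain ⟨ξ, -, hhouse, hne, hvan⟩ := B.exists_auxiliary₂ D' T S₀ hT hpq
  refine ⟨B.auxForm ξ, isHomogeneous_homog _ _, hne, fun s hs => ?_⟩
  exact B.vanishesAlong_newPoints hv ξ hR0 hR (fun s₀ hs₀ => hvan s₀ hs₀) (hnum ξ hhouse) hs

end BakerData

end Std

end GaGmE

end Literature.NumberTheory.Transcendental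

end
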